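import Mathlib
import Summits.Ventures.PercRepro2.TypedBundleSpine
import Summits.Ventures.PercRepro2.TypedMaskInst
import Summits.Ventures.PercRepro2.TypedMaskPieces

/-!
# The degree-three layer, conditional on the hyperstar Props (blind cell PercRepro2, p2 g3 / g5,
2026-08-25; mine-1 §25(e)(ii), the lead's decision 11:05Z; clause (4′) per the lead's ruling
11:49:41Z and ref-2's correction C1 11:56:01Z)

THE HYPERSTAR PROPS `HyperProps R` (the conjecture of record, in the masked vocabulary): on every
instance pinned closed with mixed types and distinct marks, for every three distinct vertices
`v₁, v₂, v₃`, the hyper-objects of the star are nonnegative — the triangle in one copy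
(`pE (tri)`), in two copies (`pE2 (tri)`), the triangle in one copy with a pair in another
(`pM (tri) (pair)`, three pairs), and (4′) the three pairs in the three copies together with the
THREE triangle-pair objects (`TvT_h := pB + pM (tri) (v₁v₂) + pM (tri) (v₁v₃) + pM (tri) (v₂v₃)`).
These are mine-1's census-true family (§23.1 on `K₅`, §24(e)/(f) over bases with one and two more
unmarked vertices; §27 addenda 2–3 with two and three unmarked terminals). The v29 form of clause
(4) — `pB + pM (tri) (pair) ≥ 0` for SOME pair — is FALSE (mine-1 g22, kit j238542, and the lead's
twin, NEG-144: base `K₅ + w`, `w ~ {o, a₁}` (1,1), all type 1: `pB = −100`, `pM = 0 / 60 / 80`,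
every `pB + pM (tri, S) < 0`, `TvT_h = +40`); (4′) survives every census of record.
THE LAYER: under the Props, every core instance with an unmarked vertex of typed degree three —
ANY neighbours — reduces (`starSumM_nonneg_of_props` + the pieces identities: the remaining
pieces `pN`, `pE (pair)`, `pE2 (pair)`, `pC + pE (tri)` are typed instances with fewer typed edges,
handled by the bounded spine), so `HCov_all_of_residualCoreTB3_all (hH : HyperProps R)`: the crux
of record from row 2′TRI on the core instances without two-terminal parts, root bundles and
unmarked vertices of degree three. `pB` occurs in exactly one of the eight type vectors,
`starSumM 2 2 2 = pE2 (tri) + pB + (pM₁₂ + pM₁₃ + pM₂₃)` (`starSumM_222_pieces`), which (4′)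
closes verbatim; no other case touches it.
-/

namespace Summit.Ventures.PercRepro2

namespace CovForm

namespace TypedRed

open TwoTerm Restrict RootBundle Mask

section Props

variable (R : Type*) [Field R] [LinearOrder R] [IsStrictOrderedRing R]

/-- **The hyperstar Props** (the conjecture of record; clauses (1)–(3) and (4′) `TvT_h ≥ 0`). -/
def HyperProps : Prop :=
  ∀ (V E : Type) [Fintype V] [DecidableEq V] [Fintype E] [DecidableEq E]
    (ends : E → Sym2 V) (o a₁ a₂ a₃ b : V) (F : Finset E) (τ : E → ℕ),
    (∀ e ∈ F, τ e = 1 ∨ τ e = 2) → MarksDistinct o a₁ a₂ a₃ b →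
    ∀ (v₁ v₂ v₃ : V), v₁ ≠ v₂ → v₁ ≠ v₃ → v₂ ≠ v₃ →
      (0 ≤ (pE F (fun _ => false) τ ends o a₁ a₂ a₃ b (cliq {v₁, v₂, v₃}) : R)) ∧
      (0 ≤ (pE2 F (fun _ => false) τ ends o a₁ a₂ a₃ b (cliq {v₁, v₂, v₃}) : R)) ∧
      (0 ≤ (pM F (fun _ => false) τ ends o a₁ a₂ a₃ b (cliq {v₁, v₂, v₃}) (cliq {v₁, v₂}) : R)) ∧
      (0 ≤ (pM F (fun _ => false) τ ends o a₁ a₂ a₃ b (cliq {v₁, v₂, v₃}) (cliq {v₁, v₃}) : R)) ∧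
      (0 ≤ (pM F (fun _ => false) τ ends o a₁ a₂ a₃ b (cliq {v₁, v₂, v₃}) (cliq {v₂, v₃}) : R)) ∧
      (0 ≤ (pB F (fun _ => false) τ ends o a₁ a₂ a₃ b (cliq {v₁, v₂}) (cliq {v₁, v₃}) (cliq {v₂, v₃}) +
          pM F (fun _ => false) τ ends o a₁ a₂ a₃ b (cliq {v₁, v₂, v₃}) (cliq {v₁, v₂}) +
          pM F (fun _ => false) τ ends o a₁ a₂ a₃ b (cliq {v₁, v₂, v₃}) (cliq {v₁, v₃}) +
          pM F (fun _ => false) τ ends o a₁ a₂ a₃ b (cliq {v₁, v₂, v₃}) (cliq {v₂, v₃}) : R))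

end Props

section StarNonneg

open Classical

variable {V : Type*} [DecidableEq V] {E : Type*} [Fintype E] [DecidableEq E]
variable {R : Type*} [Field R] [LinearOrder R] [IsStrictOrderedRing R]

/-- The star sum is nonnegative at every mixed type vector when the instance pieces and the
hyper-objects are (the hyper-objects: `pE (tri)`, `pE2 (tri)`, the three `pM (tri) (pair)` and
`TvT_h = pB + pM₁₂ + pM₁₃ + pM₂₃`, clause (4′)). -/
theorem starSumM_nonneg_of_props (F : Finset E) (z : Config E) (τ : E → ℕ) (ends : E → Sym2 V)
    (o a₁ a₂ a₃ b v₁ v₂ v₃ : V)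
    (hN : 0 ≤ (pN F z τ ends o a₁ a₂ a₃ b : R))
    (hE12 : 0 ≤ (pE F z τ ends o a₁ a₂ a₃ b (cliq {v₁, v₂}) : R))
    (hE13 : 0 ≤ (pE F z τ ends o a₁ a₂ a₃ b (cliq {v₁, v₃}) : R))
    (hE23 : 0 ≤ (pE F z τ ends o a₁ a₂ a₃ b (cliq {v₂, v₃}) : R))
    (hE212 : 0 ≤ (pE2 F z τ ends o a₁ a₂ a₃ b (cliq {v₁, v₂}) : R))
    (hE213 : 0 ≤ (pE2 F z τ ends o a₁ a₂ a₃ b (cliq {v₁, v₃}) : R))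
    (hE223 : 0 ≤ (pE2 F z τ ends o a₁ a₂ a₃ b (cliq {v₂, v₃}) : R))
    (hC1 : 0 ≤ (pC F z τ ends o a₁ a₂ a₃ b (cliq {v₁, v₃}) (cliq {v₂, v₃}) +
      pE F z τ ends o a₁ a₂ a₃ b (cliq {v₁, v₂, v₃}) : R))
    (hC2 : 0 ≤ (pC F z τ ends o a₁ a₂ a₃ b (cliq {v₁, v₂}) (cliq {v₂, v₃}) +
      pE F z τ ends o a₁ a₂ a₃ b (cliq {v₁, v₂, v₃}) : R))
    (hC3 : 0 ≤ (pC F z τ ends o a₁ a₂ a₃ b (cliq {v₁, v₂}) (cliq {v₁, v₃}) +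
      pE F z τ ends o a₁ a₂ a₃ b (cliq {v₁, v₂, v₃}) : R))
    (hT1 : 0 ≤ (pE F z τ ends o a₁ a₂ a₃ b (cliq {v₁, v₂, v₃}) : R))
    (hT2 : 0 ≤ (pE2 F z τ ends o a₁ a₂ a₃ b (cliq {v₁, v₂, v₃}) : R))
    (hM12 : 0 ≤ (pM F z τ ends o a₁ a₂ a₃ b (cliq {v₁, v₂, v₃}) (cliq {v₁, v₂}) : R))
    (hM13 : 0 ≤ (pM F z τ ends o a₁ a₂ a₃ b (cliq {v₁, v₂, v₃}) (cliq {v₁, v₃}) : R))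
    (hM23 : 0 ≤ (pM F z τ ends o a₁ a₂ a₃ b (cliq {v₁, v₂, v₃}) (cliq {v₂, v₃}) : R))
    (hTvT : 0 ≤ (pB F z τ ends o a₁ a₂ a₃ b (cliq {v₁, v₂}) (cliq {v₁, v₃}) (cliq {v₂, v₃}) +
        pM F z τ ends o a₁ a₂ a₃ b (cliq {v₁, v₂, v₃}) (cliq {v₁, v₂}) +
        pM F z τ ends o a₁ a₂ a₃ b (cliq {v₁, v₂, v₃}) (cliq {v₁, v₃}) +
        pM F z τ ends o a₁ a₂ a₃ b (cliq {v₁, v₂, v₃}) (cliq {v₂, v₃}) : R))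
    {t₁ t₂ t₃ : ℕ} (h1 : t₁ = 1 ∨ t₁ = 2) (h2 : t₂ = 1 ∨ t₂ = 2) (h3 : t₃ = 1 ∨ t₃ = 2) :
    0 ≤ (starSumM F z τ ends o a₁ a₂ a₃ b v₁ v₂ v₃ t₁ t₂ t₃ : R) := by
  rcases h1 with rfl | rfl <;> rcases h2 with rfl | rfl <;> rcases h3 with rfl | rfl
  · rw [starSumM_111_pieces]; linarith
  · rw [starSumM_112_pieces]; linarith
  · rw [starSumM_121_pieces]; linarith
  · rw [starSumM_122_pieces]; linarith
  · rw [starSumM_211_pieces]; linarith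
  · rw [starSumM_212_pieces]; linarith
  · rw [starSumM_221_pieces]; linarith
  · rw [starSumM_222_pieces]; linarith

end StarNonneg

section Part

variable {V : Type*} {E : Type*} [DecidableEq E]

/-- An unmarked vertex of typed degree three: its typed edges are exactly `e₁, e₂, e₃`. -/
def HasDeg3 (ends : E → Sym2 V) (o a₁ a₂ a₃ b : V) (F : Finset E) : Prop :=
  ∃ (u : V) (e₁ e₂ e₃ : E), (u ≠ o ∧ u ≠ a₁ ∧ u ≠ a₂ ∧ u ≠ a₃ ∧ u ≠ b) ∧
    e₁ ∈ F ∧ e₂ ∈ F ∧ e₃ ∈ F ∧ e₁ ≠ e₂ ∧ e₁ ≠ e₃ ∧ e₂ ≠ e₃ ∧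
    u ∈ ends e₁ ∧ u ∈ ends e₂ ∧ u ∈ ends e₃ ∧
    ∀ e ∈ F, u ∈ ends e → e = e₁ ∨ e = e₂ ∨ e = e₃

end Part

section Core

variable {V : Type*} {E : Type*} [DecidableEq V] [Fintype E] [DecidableEq E]

/-- **The core without two-terminal parts, root bundles and unmarked vertices of degree three.** -/
structure ResidualCoreTB3 (ends : E → Sym2 V) (o a₁ a₂ a₃ b : V) (F : Finset E) : Prop where
  core : ResidualCore ends o a₁ a₂ a₃ b F
  no_twoTerminal : ¬ HasTwoTerminalPart ends o a₁ a₂ a₃ b F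
  no_rootBundle : ¬ HasRootBundle ends o a₁ a₂ a₃ b F
  no_deg3 : ¬ HasDeg3 ends o a₁ a₂ a₃ b F

end Core

section Closure

variable (R : Type*) [Field R] [LinearOrder R] [IsStrictOrderedRing R]

/-- **Row 2′TRI on `ResidualCoreTB3`, over every finite graph.** -/
def ResidualCoreTB3_all : Prop :=
  ∀ (V E : Type) [Fintype V] [DecidableEq V] [Fintype E] [DecidableEq E]
    (ends : E → Sym2 V) (o a₁ a₂ a₃ b : V) (F : Finset E) (τ : E → ℕ),
    (∀ e ∈ F, τ e = 1 ∨ τ e = 2) → ResidualCoreTB3 ends o a₁ a₂ a₃ b F →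
      0 ≤ typedCount F (fun _ => false) τ
        (K3 ends o a₁ a₂ a₃ b : Config E → Config E → Config E → R)

end Closure

/-! ## The layer -/

section Layer

open Classical

variable {V : Type*} {E : Type*}

/-- A vertex of an edge has an other end. -/
lemma exists_other_end_star {ends : E → Sym2 V} {e : E} {u : V} (h : u ∈ ends e) :
    ∃ v, ends e = s(u, v) := by
  obtain ⟨⟨p, q⟩, hpq⟩ := Quot.exists_rep (ends e)
  have hends : ends e = s(p, q) := hpq.symm
  rw [hends, Sym2.mem_iff] at h
  rcases h with rfl | rfl
  · exact ⟨q, hends⟩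
  · exact ⟨p, by rw [hends, Sym2.eq_swap]⟩

variable (R : Type*) [Field R] [LinearOrder R] [IsStrictOrderedRing R]

/-- **(TRI) on the core from (TRI) on the core without two-terminal parts, root bundles and
unmarked vertices of degree three, under the hyperstar Props** — the induction of
`residualCore_all_of_residualCoreTB_all` with a third case: an unmarked vertex `u` of typed degree
three with neighbours `v₁, v₂, v₃` is the star sum of masked counts of the base (`typedCount_star3_sum`),
nonnegative by the pieces identities, the instance pieces being typed instances with fewer typed
edges (the bounded spine) and the hyper-objects being the Props. -/
theorem residualCore_all_of_residualCoreTB3_all (hH : HyperProps R) (hc : ResidualCoreTB3_all R) :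
    ResidualCore_all R := by
  suffices h : ∀ N : ℕ, ∀ (V E : Type) [Fintype V] [DecidableEq V] [Fintype E] [DecidableEq E]
      (ends : E → Sym2 V) (o a₁ a₂ a₃ b : V) (F : Finset E) (τ : E → ℕ),
      (∀ e ∈ F, τ e = 1 ∨ τ e = 2) → ResidualCore ends o a₁ a₂ a₃ b F → F.card ≤ N →
        0 ≤ typedCount F (fun _ => false) τ
          (K3 ends o a₁ a₂ a₃ b : Config E → Config E → Config E → R) by
    intro V E _ _ _ _ ends o a₁ a₂ a₃ b F τ hτ hres
    exact h F.card V E ends o a₁ a₂ a₃ b F τ hτ hres le_rfl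
  intro N
  induction N using Nat.strong_induction_on with
  | _ N ih =>
  intro V E _ _ _ _ ends o a₁ a₂ a₃ b F τ hτ hres hN
  have tower : N - 1 < N → ∀ (E' : Type) [Fintype E'] [DecidableEq E'] (ends' : E' → Sym2 V)
      (o' a₁' a₂' a₃' b' : V) (F' : Finset E') (τ' : E' → ℕ), (∀ e ∈ F', τ' e = 1 ∨ τ' e = 2) →
      ResidualR ends' o' a₁' a₂' a₃' b' F' → F'.card ≤ N - 1 →
        0 ≤ typedCount F' (fun _ => false) τ'
          (K3 ends' o' a₁' a₂' a₃' b' : Config E' → Config E' → Config E' → R) := by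
    intro hN1 E' _ _ ends' o' a₁' a₂' a₃' b' F' τ' hτ' hR hcard
    by_cases hcon : Conn ends' (typedConfig F') a₁' a₂'
    · by_cases hbr : RootBridge.HasRootBridgeSameSide' ends' o' a₁' a₂' b' F'
      · exact RootBridge.typedCount_nonneg_of_hasRootBridgeSameSide' ends' o' a₁' a₂' a₃' b' F'
          τ' hτ' hbr
      by_cases hm : MarksDistinct o' a₁' a₂' a₃' b'
      · exact ih (N - 1) hN1 V E' ends' o' a₁' a₂' a₃' b' F' τ' hτ'
          ⟨⟨⟨hR.residual, hcon⟩, hR.root_reach⟩, hbr, hm⟩ hcard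
      · rw [typedCount_eq_zero_of_not_marksDistinct ends' hm]
    · exact Separated.typedCount_nonneg_of_typedConfig_sep ends' o' a₁' a₂' a₃' b' F' τ' hτ' hcon
  have step : N - 1 < N → ∀ (ends' : E → Sym2 V) (F' : Finset E) (τ' : E → ℕ),
      (∀ e ∈ F', τ' e ≤ 3) → F'.card ≤ N - 1 →
        0 ≤ typedCount F' (fun _ => false) τ'
          (K3 ends' o a₁ a₂ a₃ b : Config E → Config E → Config E → R) := by
    intro hN1 ends' F' τ' hτ3 hcard
    rw [typedCount_mixed_of_le_three F' _ τ' hτ3]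
    refine typedCount_nonneg_of_residualR_card_le (N - 1) (tower hN1) ends' o a₁ a₂ a₃ b _ _ _
      (fun e he => (mem_mixedPart.1 he).2) ?_
    exact le_trans (Finset.card_le_card (support_pinNonMixed_subset F' τ')) hcard
  have hz0 : ∀ L : Finset E, offL L (fun _ : E => false) = fun _ => false := fun L => by
    funext e; simp [offL]
  by_cases hT : HasTwoTerminalPart ends o a₁ a₂ a₃ b F
  · obtain ⟨I, s, t, L, hP⟩ := hT
    obtain ⟨h₀, h₀L⟩ : ∃ h₀, h₀ ∈ L := Finset.card_pos.1 (by have := hP.two_le; omega)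
    have hLF := Finset.card_le_card hP.sub
    have hN1 : N - 1 < N := by have := hP.two_le; omega
    have hh₀ : h₀ ∉ F \ L := fun h => (Finset.mem_sdiff.1 h).2 h₀L
    refine typedCount_nonneg_of_twoTerminal ends o a₁ a₂ a₃ b hP.s_ext hP.t_ext hP.unmarked
      hP.ends_in h₀L hP.sub _ τ (fun e he hv => ⟨hP.closed e he hv, rfl⟩) ?_
    intro k hk
    rw [hz0]
    refine step hN1 _ _ _ (fun e he => ?_) ?_
    · rcases Finset.mem_insert.1 he with rfl | he
      · rw [Function.update_self]; exact hk
      · rw [Function.update_of_ne (fun h => hh₀ (by rw [← h]; exact he))]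
        rcases hτ e (Finset.mem_sdiff.1 he).1 with h | h <;> omega
    · rw [Finset.card_insert_of_notMem hh₀, Finset.card_sdiff_of_subset hP.sub]
      have := hP.two_le
      omega
  by_cases hB : HasRootBundle ends o a₁ a₂ a₃ b F
  · obtain ⟨I, v, L, hP⟩ := hB
    obtain ⟨h₁, h₁L, h₂, h₂L, h12⟩ : ∃ h₁ ∈ L, ∃ h₂ ∈ L, h₁ ≠ h₂ :=
      Finset.one_lt_card.1 (by have := hP.three_le; omega)
    have hLF := Finset.card_le_card hP.sub
    have hN1 : N - 1 < N := by have := hP.three_le; omega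
    have hh₁ : h₁ ∉ F \ L := fun h => (Finset.mem_sdiff.1 h).2 h₁L
    have hh₂ : h₂ ∉ insert h₁ (F \ L) := by
      rw [Finset.mem_insert, not_or]
      exact ⟨Ne.symm h12, fun h => (Finset.mem_sdiff.1 h).2 h₂L⟩
    refine typedCount_nonneg_of_rootBundle ends o a₁ a₂ a₃ b hP.v_ext hP.unmarked hP.ends_in
      h₁L h₂L h12 hP.sub _ τ (fun e he hv => ⟨hP.closed e he hv, rfl⟩) ?_
    intro k₁ k₂ hk₁ hk₂
    rw [hz0]
    refine step hN1 _ _ _ (fun e he => ?_) ?_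
    · rcases Finset.mem_insert.1 he with rfl | he
      · rw [Function.update_self]; exact hk₂
      · rw [Function.update_of_ne (fun h => hh₂ (by rw [← h]; exact he))]
        rcases Finset.mem_insert.1 he with rfl | he
        · rw [Function.update_self]; exact hk₁
        · rw [Function.update_of_ne (fun h => hh₁ (by rw [← h]; exact he))]
          rcases hτ e (Finset.mem_sdiff.1 he).1 with h | h <;> omega
    · rw [Finset.card_insert_of_notMem hh₂, Finset.card_insert_of_notMem hh₁,
        Finset.card_sdiff_of_subset hP.sub]
      have := hP.three_le
      omega
  by_cases hD : HasDeg3 ends o a₁ a₂ a₃ b F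
  · obtain ⟨u, e₁, e₂, e₃, hu, h1, h2, h3, h12, h13, h23, hu1, hu2, hu3, hdeg⟩ := hD
    obtain ⟨v₁, he₁⟩ := exists_other_end_star hu1
    obtain ⟨v₂, he₂⟩ := exists_other_end_star hu2
    obtain ⟨v₃, he₃⟩ := exists_other_end_star hu3
    have hred := hres.residualConR.residualCon.residual.reduced
    have hv₁ : v₁ ≠ u := fun h => hred.no_loop e₁ h1 (by rw [he₁, h]; exact Sym2.mk_isDiag_iff.2 rfl)
    have hv₂ : v₂ ≠ u := fun h => hred.no_loop e₂ h2 (by rw [he₂, h]; exact Sym2.mk_isDiag_iff.2 rfl)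
    have hv₃ : v₃ ≠ u := fun h => hred.no_loop e₃ h3 (by rw [he₃, h]; exact Sym2.mk_isDiag_iff.2 rfl)
    have hv12 : v₁ ≠ v₂ := fun h => hred.no_parallel e₁ h1 e₂ h2 h12 (by rw [he₁, he₂, h])
    have hv13 : v₁ ≠ v₃ := fun h => hred.no_parallel e₁ h1 e₃ h3 h13 (by rw [he₁, he₃, h])
    have hv23 : v₂ ≠ v₃ := fun h => hred.no_parallel e₂ h2 e₃ h3 h23 (by rw [he₂, he₃, h])
    have hF3 : 3 ≤ F.card := by
      have hsub : ({e₁, e₂, e₃} : Finset E) ⊆ F := by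
        intro e he
        simp only [Finset.mem_insert, Finset.mem_singleton] at he
        rcases he with rfl | rfl | rfl <;> assumption
      have hc3 : ({e₁, e₂, e₃} : Finset E).card = 3 := by
        rw [Finset.card_insert_of_notMem, Finset.card_insert_of_notMem, Finset.card_singleton]
        · simp [h23]
        · simp [h12, h13]
      have := Finset.card_le_card hsub
      omega
    have hN1 : N - 1 < N := by omega
    rw [typedCount_star3_sum ends o a₁ a₂ a₃ b hu he₁ he₂ he₃ hv₁ hv₂ hv₃ h12 h13 h23 h1 h2 h3
      (fun _ => false) τ (fun e hue => by
        by_cases heF : e ∈ F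
        · rcases hdeg e heF hue with rfl | rfl | rfl
          · exact Or.inl rfl
          · exact Or.inr (Or.inl rfl)
          · exact Or.inr (Or.inr (Or.inl rfl))
        · exact Or.inr (Or.inr (Or.inr ⟨heF, rfl⟩)))]
    set B := ((F.erase e₁).erase e₂).erase e₃ with hB
    have hz' : Function.update (Function.update (Function.update (fun _ : E => false) e₁ false)
        e₂ false) e₃ false = fun _ => false := by
      funext e; by_cases h1' : e = e₁ <;> by_cases h2' : e = e₂ <;> by_cases h3' : e = e₃ <;>
        simp [h1', h2', h3']
    rw [hz']
    have hBF : B ⊆ F := fun e he =>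
      Finset.mem_of_mem_erase (Finset.mem_of_mem_erase (Finset.mem_of_mem_erase he))
    have hcardB : B.card = F.card - 3 := by
      rw [hB, Finset.card_erase_of_mem, Finset.card_erase_of_mem, Finset.card_erase_of_mem h1]
      · omega
      · exact Finset.mem_erase.2 ⟨h12.symm, h2⟩
      · exact Finset.mem_erase.2 ⟨h23.symm, Finset.mem_erase.2 ⟨h13.symm, h3⟩⟩
    have hτB : ∀ e ∈ B, τ e = 1 ∨ τ e = 2 := fun e he => hτ e (hBF he)
    have he₁B : e₁ ∉ B := fun h => (Finset.mem_erase.1 (Finset.mem_erase.1 (Finset.mem_erase.1 h).2).2).1 rfl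
    have he₂B : e₂ ∉ B := fun h => (Finset.mem_erase.1 (Finset.mem_erase.1 h).2).1 rfl
    have he₃B : e₃ ∉ B := fun h => (Finset.mem_erase.1 h).1 rfl
    -- the instance pieces are typed instances with fewer typed edges
    have hinst1 : ∀ (v w : V) (k : ℕ), k ≤ 3 → 0 ≤ typedCount (insert e₁ B) (fun _ => false)
        (Function.update τ e₁ k) (K3 (Function.update ends e₁ s(v, w)) o a₁ a₂ a₃ b :
          Config E → Config E → Config E → R) := by
      intro v w k hk
      refine step hN1 _ _ _ (fun e he => ?_) ?_
      · rcases Finset.mem_insert.1 he with rfl | he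
        · rw [Function.update_self]; exact hk
        · rw [Function.update_of_ne (fun h => he₁B (by rw [← h]; exact he))]
          rcases hτB e he with h | h <;> omega
      · rw [Finset.card_insert_of_notMem he₁B, hcardB]; omega
    have hinst2 : ∀ (v₁' v₂' v₃' : V), 0 ≤ typedCount (insert e₂ (insert e₁ B)) (fun _ => false)
        (Function.update (Function.update τ e₁ 1) e₂ 1)
        (K3 (Function.update (Function.update ends e₁ s(v₁', v₃')) e₂ s(v₂', v₃')) o a₁ a₂ a₃ b :
          Config E → Config E → Config E → R) := by
      intro v₁' v₂' v₃'
      have he₂B' : e₂ ∉ insert e₁ B := by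
        rw [Finset.mem_insert, not_or]; exact ⟨h12.symm, he₂B⟩
      refine step hN1 _ _ _ (fun e he => ?_) ?_
      · rcases Finset.mem_insert.1 he with rfl | he
        · rw [Function.update_self]; omega
        · rw [Function.update_of_ne (fun h => he₂B' (by rw [← h]; exact he))]
          rcases Finset.mem_insert.1 he with rfl | he
          · rw [Function.update_self]; omega
          · rw [Function.update_of_ne (fun h => he₁B (by rw [← h]; exact he))]
            rcases hτB e he with h | h <;> omega
      · rw [Finset.card_insert_of_notMem he₂B', Finset.card_insert_of_notMem he₁B, hcardB]; omega
    have hN0 : 0 ≤ (pN B (fun _ => false) τ ends o a₁ a₂ a₃ b : R) := by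
      rw [pN_eq]
      refine step hN1 _ _ _ (fun e he => ?_) ?_
      · rcases hτB e he with h | h <;> omega
      · rw [hcardB]; omega
    have hE : ∀ v w : V, 0 ≤ (pE B (fun _ => false) τ ends o a₁ a₂ a₃ b (cliq {v, w}) : R) := by
      intro v w
      rw [pE_eq_typedCount B _ τ ends o a₁ a₂ a₃ b he₁B rfl v w]
      exact hinst1 v w 1 (by omega)
    have hE2 : ∀ v w : V, 0 ≤ (pE2 B (fun _ => false) τ ends o a₁ a₂ a₃ b (cliq {v, w}) : R) := by
      intro v w
      rw [pE2_eq_typedCount B _ τ ends o a₁ a₂ a₃ b he₁B rfl v w]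
      exact hinst1 v w 2 (by omega)
    have hC : ∀ v₁' v₂' v₃' : V, 0 ≤ (pC B (fun _ => false) τ ends o a₁ a₂ a₃ b (cliq {v₁', v₃'})
        (cliq {v₂', v₃'}) + pE B (fun _ => false) τ ends o a₁ a₂ a₃ b (cliq {v₁', v₂', v₃'}) : R) := by
      intro v₁' v₂' v₃'
      rw [pC_pT1_eq_typedCount B _ τ ends o a₁ a₂ a₃ b he₁B he₂B h12 rfl rfl v₁' v₂' v₃']
      exact hinst2 v₁' v₂' v₃'
    obtain ⟨hT1, hT2, hM12, hM13, hM23, hTvT⟩ := hH V E ends o a₁ a₂ a₃ b B τ hτB hres.marks v₁ v₂ v₃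
      hv12 hv13 hv23
    refine starSumM_nonneg_of_props B _ τ ends o a₁ a₂ a₃ b v₁ v₂ v₃ hN0 (hE v₁ v₂) (hE v₁ v₃)
      (hE v₂ v₃) (hE2 v₁ v₂) (hE2 v₁ v₃) (hE2 v₂ v₃) (hC v₁ v₂ v₃) ?_ ?_ hT1 hT2 hM12 hM13 hM23 hTvT
      (hτ e₁ h1) (hτ e₂ h2) (hτ e₃ h3)
    · -- `pC e₁₂ e₂₃ + T`: the shared vertex `v₂` third, read from `(v₁, v₃, v₂)`
      have := hC v₁ v₃ v₂
      rw [Finset.pair_comm v₃ v₂] at this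
      exact this
    · -- `pC e₁₂ e₁₃ + T`: the shared vertex `v₁` third, read from `(v₂, v₃, v₁)`
      have := hC v₂ v₃ v₁
      rw [Finset.pair_comm v₂ v₁, Finset.pair_comm v₃ v₁, Finset.insert_comm v₂ v₁] at this
      exact this
  · exact hc V E ends o a₁ a₂ a₃ b F τ hτ ⟨hres, hT, hB, hD⟩

/-- **THE CRUX OF RECORD FROM (TRI) ON THE CORE WITHOUT TWO-TERMINAL PARTS, ROOT BUNDLES AND
UNMARKED VERTICES OF DEGREE THREE — conditional on the hyperstar Props (clauses (1)–(3), (4′)).** -/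
theorem HCov_all_of_residualCoreTB3_all (hH : HyperProps R) (hc : ResidualCoreTB3_all R) :
    HCov_all R :=
  HCov_all_of_residualCore_all R (residualCore_all_of_residualCoreTB3_all R hH hc)

end Layer

end TypedRed

end CovForm

end Summit.Ventures.PercRepro2
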